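import Summits.QuantumFields.BalabanUV.Beta.CombLamSectorLetters

/-!
# `BalabanUV.Beta.D1BFx.ColumnGaugeCombLetter` — road «BF-x», binder row D1, PART 24 (chart of record (α′), an2 R-D1-g44-2):
# THE COMB LITERAL's LEVEL-0 SLOT WARD LETTER AGAINST THE ROAD KERNEL's PARTNER `bhKAt` — EXACT, WITH ONE DISPLAYED `Dsh`-BORDER WORD
# (the located check (α) of `COLUMN-GAUGE-INSTANCE-SPEC-g23` v0.3 ∕ FINDING F-g23-3, as a kernel identity)

HONEST DEPENDENCY (cell records, verbatim): «continuum YM on T⁴ ⇐ BetaPertH ∧ nine spine estimates (0/9 proved); BetaPertH ⇐ (D1) ∧ (D4) ∧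
CAP+tail; G-an2-4 gates asym, D1 and NE2/3/4.»  HONEST FRAMING (cell contract, verbatim): «discharging `BetaPertH` makes Bałaban's UV stability
UNCONDITIONAL — a real constructive-QFT result; it is NOT the continuum limit and NOT the Clay problem.»  THIS MODULE DISCHARGES NO binder of
row D1 and NO estimate of Bałaban's: one [our object] identity between OUR kernels, assembled BY NAME from `CombLamSectorLetters.divV_S_zero_an1TablesS2`
(leaf-05∕leaf-10's Wilson and (0.4)-border letters), `WardLocusStencils.conjV_bhKAt_diagK_legInd` and an1's `AveragingWardRootedStencils.divV_vhSAt_eq_conjV`.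
No `def`, no `def … : Prop`, nothing cited, 0 sorry.  NOT D1, NOT BetaPertH, NOT continuum, NOT Clay.

ABSOLUTE RULE (cell charter, verbatim): «No internally-minted statement may enter as a cited fact. Every hypothesis is either kernel-proved in this
package or a verbatim quotation of a PUBLISHED theorem with page reference.»

THE POINT (F-g23-3).  The literal of record's border table `tabs.V = symVhSAt ρ_c` is gauge-covariant against the (0.4)-SYMMETRISED packed
first-order kernel `linSym04At ρ_c Lc` (`SymAveragingWardRootedStencils.divV_symVhSAt_eq_conjV_ctr`), whereas the road kernel's `RelInv` partner
`bhKAt` carries the RAW border `linSymAt ρ_c Lc` (`conjV_bhKAt_diagK_legInd` + `divV_vhSAt_eq_conjV`).  Hence, at level 0, for every varied site `u`: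
`divV S₀ u = (Lc⁴∕2) • conjV (bhKAt 3 ρ_c Lc) (D_u) + (−Lc⁸∕2) • conjV (mfNeg (linSym04At ρ_c Lc) − mfNeg (linSymAt ρ_c Lc)) (D_u)`, `D_u := diagK (legInd ρ_c u)` —
the first piece is the letter `ColumnGaugeGenerator.wsum_divV_eq_conjV_of_letters_smul` ∕ `ColumnGaugeInvariance.hessKer_columnGauge_of_relInv` cancel
EXACTLY at the bm pin; the second is ONE displayed border commutator word on the symmetrisation defect (an1's `Dsh` shape) — NOT of that letter's shape, hence not
removed by `hessKer_columnGauge_of_relInv`; whether it is priced at the bm pin or avoided at the comb pin is the row's Q-g23-4 (nothing about its size or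
cancellation is claimed here).  Unit `b2b-balaban-beta-d1-p2` gen 23; no existing file touched.
-/

namespace Summit.QuantumFields.BalabanUV.Beta.D1BFx.ColumnGaugeCombLetter

open Literature.MathematicalPhysics.QuantumFieldTheory
open Literature.MathematicalPhysics.QuantumFieldTheory.Balaban1983to89
open Literature.MathematicalPhysics.QuantumFieldTheory.Balaban1983to89.Beta
open ExpKernelCalculus (MKer)
open OneStepResolventKernel (Fib)
open KernelWard (divV)
open StepJetData (mfNeg)
open AveragingContoursRooted (ctr)
open AveragingHessianKernelsRooted (vhSAt)
open Summit.QuantumFields.BalabanUV.Beta.BorderedHessian (diagK conjV_diagK_apply bhKAt)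
open Summit.QuantumFields.BalabanUV.Beta.ChartConjugation (conjV)
open Summit.QuantumFields.BalabanUV.Beta.AveragingWardRootedStencils (legInd linSymAt divV_vhSAt_eq_conjV)
open Summit.QuantumFields.BalabanUV.Beta.WardLocusStencils (ffK conjV_bhKAt_diagK_legInd)
open Summit.QuantumFields.BalabanUV.Beta.DshAn1 (linSym04At)
open Summit.QuantumFields.BalabanUV.Beta.CombChartStepJets (JsB12CombSh0)
open Summit.QuantumFields.BalabanUV.Beta.SymSecondOrderTablesAn1 (symTablesAn1S2)
open Summit.QuantumFields.BalabanUV.Beta.CombLamSectorLetters (divV_S_zero_an1TablesS2)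
open Summit.QuantumFields.BalabanUV.Beta.SymShiftedSpread (conjV_sub_diagK)

noncomputable section

variable {d : ℕ}

variable {Lc : ℕ} [NeZero Lc]

/-- **THE COMB LITERAL's LEVEL-0 SLOT WARD LETTER AGAINST `bhKAt`, WITH THE `Dsh`-BORDER WORD DISPLAYED** [our object] (F-g23-3 as a kernel identity):
for the literal of record `JsB12CombSh0 hLc N (symTablesAn1S2 3 Lc cΛ) cΛ cB`, at level `0`, for every varied site `u`,
`divV S₀ u = (Lc⁴∕2) • conjV (bhKAt 3 ρ_c Lc) (diagK (legInd ρ_c u)) + (−Lc⁸∕2) • conjV (mfNeg (linSym04At ρ_c Lc) − mfNeg (linSymAt ρ_c Lc)) (diagK (legInd ρ_c u))`,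
`ρ_c = ctr 4 Lc` — the first piece has the letter shape that column-gauge invariance cancels at the road's bm pin (`RelInv G₀^{bm} bhKAt axEc`), the second is the
symmetrisation-defect border commutator, which is not of that shape (no claim about it beyond the identity). -/
theorem divV_S_zero_eq_bhKAt_add_borderDefect (hLc : Odd Lc) (N : ℕ) (cΛ cB : ℝ) (u : Fin 4 → ℤ) :
    divV (JsB12CombSh0 hLc N (symTablesAn1S2 3 Lc cΛ) cΛ cB 0).S u
      = ((Lc : ℝ) ^ 4 / 2) • conjV (bhKAt 3 (ctr 4 Lc) Lc) (diagK (legInd (ctr 4 Lc) u))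
        + (-((Lc : ℝ) ^ 8 / 2)) •
            conjV (mfNeg (linSym04At (ctr 4 Lc) Lc) - mfNeg (linSymAt (ctr 4 Lc) Lc)) (diagK (legInd (ctr 4 Lc) u)) := by
  have hL : 1 ≤ Lc := hLc.pos
  rw [divV_S_zero_an1TablesS2 hLc N cΛ cB (ctr 4 Lc) Lc u, conjV_bhKAt_diagK_legInd (ctr 4 Lc) Lc hL u,
    divV_vhSAt_eq_conjV hL (ctr 4 Lc) u, conjV_sub_diagK]
  funext x z a b
  simp only [Pi.add_apply, Pi.smul_apply, Pi.sub_apply, smul_eq_mul]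
  ring

/-- **THE SAME, AS «LETTER + DEFECT»**: `divV S₀ u − (Lc⁴∕2) • conjV bhKAt D_u = (−Lc⁸∕2) • conjV (ΔmfNeg) D_u` — the shape the successor's FILE 1-comb hands to
`ColumnGaugeGenerator.wsum_conjV_diagK_legInd` (the defect word superposes to ONE commutator with the column-gauge generator `Λ_χ`). -/
theorem divV_S_zero_sub_letter_eq_borderDefect (hLc : Odd Lc) (N : ℕ) (cΛ cB : ℝ) (u : Fin 4 → ℤ) :
    divV (JsB12CombSh0 hLc N (symTablesAn1S2 3 Lc cΛ) cΛ cB 0).S u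
        - ((Lc : ℝ) ^ 4 / 2) • conjV (bhKAt 3 (ctr 4 Lc) Lc) (diagK (legInd (ctr 4 Lc) u))
      = (-((Lc : ℝ) ^ 8 / 2)) •
          conjV (mfNeg (linSym04At (ctr 4 Lc) Lc) - mfNeg (linSymAt (ctr 4 Lc) Lc)) (diagK (legInd (ctr 4 Lc) u)) := by
  rw [divV_S_zero_eq_bhKAt_add_borderDefect hLc N cΛ cB u, add_sub_cancel_left]

end

end Summit.QuantumFields.BalabanUV.Beta.D1BFx.ColumnGaugeCombLetter
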